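import Mathlib
import Summits.Ventures.PercRepro2.SwOutCrossJunctionAny
import Summits.Ventures.PercRepro2.SwOutCrossJunctionExample2
import Summits.Ventures.PercRepro2.SwOutCrossJunctionExample3

/-!
# The any-graph theorem on the instances (blind cell PercRepro2, night-4 g25, 2026-08-28;
proofs/NIGHT4-G25.md §5)

`sw_of_crossJunction_any` applies to a cross junction AS GIVEN — no presentation of its cross
graph as a sum of components, no connectivity: on `crossEx2` (a cross edge and a single dropped
vertex, `sw_crossEx2_any`) and on g24's `crossEx3` (a triangle, `sw_crossEx3_any`), directly.
-/

namespace Summit.Ventures.PercRepro2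

namespace CrossArm

open Hull LocRows

open scoped Classical

/-- **Row (SW) on `crossEx2` by the any-graph theorem**, the cross graph `⊤ ⊕g ⊤` taken as it is. -/
theorem sw_crossEx2_any : Sw crossEx2 0 1 2 :=
  sw_of_crossJunction_any (by decide) crossEx2_junction

/-- **Row (SW) on g24's `crossEx3` by the any-graph theorem** (a triangle of dropped vertices). -/
theorem sw_crossEx3_any : Sw crossEx3 0 1 2 :=
  sw_of_crossJunction_any (by decide) crossEx3_junction

end CrossArm

end Summit.Ventures.PercRepro2
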